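import Summits.Ventures.PercRepro.S2CoindepCount

/-!
# PercRepro — S2: THE `m`-SUBSETS WITH PRESCRIBED INTERSECTIONS WITH TWO DISJOINT SETS (p7, gen 15; sub-claim S2)

For disjoint `W₁, W₂ ⊆ E` (finsets): the `m`-subsets `X ⊆ E` with `|X ∩ W₁| = i` and `|X ∩ W₂| = j` number at most
`C(|W₁|, i) · C(|W₂|, j) · C(|E| − |W₁| − |W₂|, m − i − j)` (**`ncard_subsets_inter_eq_two_le`**: the injection
`X ↦ (X ∩ W₁, X ∖ W₁)` into `𝒫_i(W₁) ×ˢ {Y ⊆ E ∖ W₁ : |Y| = m − i, |Y ∩ W₂| = j}` and `S2.ncard_subsets_inter_eq_le`), and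
those with `|X ∩ W₁| ≥ a` and `|X ∩ W₂| ≥ b` at most the double sum over `i ∈ [a, m]`, `j ∈ [b, m − i]`
(**`ncard_subsets_inter_ge_two_le`**). The two-cluster counts of the rows `t = 4, 5` of the cell `(13, 6)` (S2 v49 §GAP (af)).
Nothing about any cell is claimed. Axioms: standard.
-/

namespace PercRepro

namespace S2

open Set

variable {α : Type}

/-- **Prescribed intersections with two disjoint sets**: `#{X ⊆ E : |X| = m, |X ∩ W₁| = i, |X ∩ W₂| = j} ≤
C(|W₁|, i) · C(|W₂|, j) · C(|E| − |W₁| − |W₂|, m − i − j)`. -/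
theorem ncard_subsets_inter_eq_two_le (E W₁ W₂ : Finset α) (hW₁ : W₁ ⊆ E) (hW₂ : W₂ ⊆ E) (hdis : Disjoint W₁ W₂)
    (m i j : ℕ) :
    {X : Set α | X ⊆ (E : Set α) ∧ X.ncard = m ∧ (X ∩ (W₁ : Set α)).ncard = i ∧ (X ∩ (W₂ : Set α)).ncard = j}.ncard ≤
      W₁.card.choose i * (W₂.card.choose j * (E.card - W₁.card - W₂.card).choose (m - i - j)) := by
  classical
  set A : Set (Set α) := {Y : Set α | Y ⊆ ((W₁ : Finset α) : Set α) ∧ Y.ncard = i} with hA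
  set Bs : Set (Set α) := {Y : Set α | Y ⊆ ((E \ W₁ : Finset α) : Set α) ∧ Y.ncard = m - i ∧
    (Y ∩ (W₂ : Set α)).ncard = j} with hBs
  have hAcard : A.ncard = W₁.card.choose i := PercRepro.ncard_subsets_ncard_eq W₁ i
  have hW₂' : W₂ ⊆ E \ W₁ := Finset.subset_sdiff.2 ⟨hW₂, hdis.symm⟩
  have hBcard : Bs.ncard ≤ W₂.card.choose j * (E.card - W₁.card - W₂.card).choose (m - i - j) := by
    have h := ncard_subsets_inter_eq_le (E \ W₁) W₂ hW₂' (m - i) j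
    rw [Finset.card_sdiff_of_subset hW₁] at h
    rw [show m - i - j = m - i - j from rfl]
    exact h
  have hAfin : A.Finite := (W₁.finite_toSet.finite_subsets).subset (fun Y hY => hY.1)
  have hBfin : Bs.Finite := ((E \ W₁).finite_toSet.finite_subsets).subset (fun Y hY => hY.1)
  calc {X : Set α | X ⊆ (E : Set α) ∧ X.ncard = m ∧ (X ∩ (W₁ : Set α)).ncard = i ∧ (X ∩ (W₂ : Set α)).ncard = j}.ncard
      ≤ (A ×ˢ Bs).ncard := by
        refine Set.ncard_le_ncard_of_injOn (fun X => (X ∩ (W₁ : Set α), X \ (W₁ : Set α))) ?_ ?_ (hAfin.prod hBfin)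
        · rintro X ⟨hXE, hXm, hXi, hXj⟩
          have hXfin : X.Finite := E.finite_toSet.subset hXE
          refine Set.mem_prod.2 ⟨⟨inter_subset_right, hXi⟩, ⟨?_, ?_, ?_⟩⟩
          · show X \ (W₁ : Set α) ⊆ ((E \ W₁ : Finset α) : Set α)
            rw [Finset.coe_sdiff]
            exact sdiff_subset_sdiff_left hXE
          · show (X \ (W₁ : Set α)).ncard = m - i
            have h := Set.ncard_inter_add_ncard_sdiff_eq_ncard X (W₁ : Set α) hXfin
            rw [hXi, hXm] at h
            omega
          · show ((X \ (W₁ : Set α)) ∩ (W₂ : Set α)).ncard = j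
            have : (X \ (W₁ : Set α)) ∩ (W₂ : Set α) = X ∩ (W₂ : Set α) := by
              ext y
              simp only [Set.mem_inter_iff, Set.mem_sdiff, Finset.mem_coe]
              constructor
              · rintro ⟨⟨hy, -⟩, hy2⟩; exact ⟨hy, hy2⟩
              · rintro ⟨hy, hy2⟩
                exact ⟨⟨hy, fun hy1 => Finset.disjoint_left.1 hdis hy1 hy2⟩, hy2⟩
            rw [this, hXj]
        · rintro X ⟨hXE, -, -, -⟩ Y ⟨hYE, -, -, -⟩ hXY
          simp only [Prod.mk.injEq] at hXY
          rw [← Set.inter_union_sdiff X (W₁ : Set α), hXY.1, hXY.2, Set.inter_union_sdiff]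
    _ = A.ncard * Bs.ncard := Set.ncard_prod
    _ ≤ W₁.card.choose i * (W₂.card.choose j * (E.card - W₁.card - W₂.card).choose (m - i - j)) := by
        rw [hAcard]
        exact Nat.mul_le_mul_left _ hBcard

/-- **At least `a` points in `W₁` and `b` in `W₂`** (disjoint `W₁, W₂ ⊆ E`): at most the double sum of the prescribed counts over
`i ∈ [a, m]`, `j ∈ [b, m]`. -/
theorem ncard_subsets_inter_ge_two_le (E W₁ W₂ : Finset α) (hW₁ : W₁ ⊆ E) (hW₂ : W₂ ⊆ E) (hdis : Disjoint W₁ W₂)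
    (m a b : ℕ) :
    {X : Set α | X ⊆ (E : Set α) ∧ X.ncard = m ∧ a ≤ (X ∩ (W₁ : Set α)).ncard ∧ b ≤ (X ∩ (W₂ : Set α)).ncard}.ncard ≤
      ∑ i ∈ Finset.Icc a m, ∑ j ∈ Finset.Icc b (m - i),
        W₁.card.choose i * (W₂.card.choose j * (E.card - W₁.card - W₂.card).choose (m - i - j)) := by
  classical
  have hfinE : ∀ S : Set (Set α), S ⊆ {X : Set α | X ⊆ (E : Set α)} → S.Finite :=
    fun S hS => (E.finite_toSet.finite_subsets).subset hS
  -- the family lies in the double union of the prescribed families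
  have hcover : {X : Set α | X ⊆ (E : Set α) ∧ X.ncard = m ∧ a ≤ (X ∩ (W₁ : Set α)).ncard ∧ b ≤ (X ∩ (W₂ : Set α)).ncard} ⊆
      ⋃ i ∈ Finset.Icc a m, ⋃ j ∈ Finset.Icc b (m - i),
        {X : Set α | X ⊆ (E : Set α) ∧ X.ncard = m ∧ (X ∩ (W₁ : Set α)).ncard = i ∧ (X ∩ (W₂ : Set α)).ncard = j} := by
    rintro X ⟨hXE, hXm, hXa, hXb⟩
    have hXfin : X.Finite := E.finite_toSet.subset hXE
    have h1 : (X ∩ (W₁ : Set α)).ncard ≤ m := hXm ▸ Set.ncard_le_ncard Set.inter_subset_left hXfin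
    -- `|X ∩ W₁| + |X ∩ W₂| ≤ |X|` (disjoint pieces of `X`)
    have h12 : (X ∩ (W₁ : Set α)).ncard + (X ∩ (W₂ : Set α)).ncard ≤ m := by
      have hd : Disjoint (X ∩ (W₁ : Set α)) (X ∩ (W₂ : Set α)) :=
        (Finset.disjoint_coe.2 hdis).mono Set.inter_subset_right Set.inter_subset_right
      rw [← Set.ncard_union_eq hd (hXfin.subset Set.inter_subset_left) (hXfin.subset Set.inter_subset_left), ← hXm]
      exact Set.ncard_le_ncard (Set.union_subset Set.inter_subset_left Set.inter_subset_left) hXfin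
    simp only [Set.mem_iUnion, Finset.mem_Icc, Set.mem_setOf_eq]
    exact ⟨_, ⟨hXa, h1⟩, _, ⟨hXb, by omega⟩, hXE, hXm, rfl, rfl⟩
  refine (Set.ncard_le_ncard hcover ?_).trans ?_
  · exact hfinE _ (fun X hX => by
      simp only [Set.mem_iUnion, Set.mem_setOf_eq] at hX
      obtain ⟨i, -, j, -, hXE, -, -, -⟩ := hX
      exact hXE)
  refine (Finset.set_ncard_biUnion_le (Finset.Icc a m) _).trans (Finset.sum_le_sum fun i _ => ?_)
  refine (Finset.set_ncard_biUnion_le (Finset.Icc b (m - i)) _).trans (Finset.sum_le_sum fun j _ => ?_)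
  exact ncard_subsets_inter_eq_two_le E W₁ W₂ hW₁ hW₂ hdis m i j

end S2

end PercRepro
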